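import Literature.AlgebraicGeometry.Motives.HodgeStructureLefschetzGroupPoints
import Literature.AlgebraicGeometry.Motives.HodgeGroupKernelMultiplierCharacter
import Literature.AlgebraicGeometry.Motives.MumfordTateGroupScalarsPoints
import Literature.Algebra.Lie.KillingBaseChange
import HarnessLib

/-!
# Milne 1999 §4 on the abstract polarized `ℚ`-Hodge structure, on `K`-points: the Lefschetz group
# `L(A) ⊂ GL(V(A)) × 𝔾_m` as the fixing group of the divisor classes, Theorem 4.4 `γ ↦ (γ, γ†γ) : G(A) ⥲ L(A)`,
# the cocharacters `l(A)`, `w` with `Ker l(A) = S(A)` and `l ∘ w = -2`, `L(A) ⊃ Hg(A)`, and Proposition 4.8 (b) ⇔ (c)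

[topic AlgebraicGeometry/Motives]

Layer `Literature/AlgebraicGeometry/Motives`, lane `lit-hodgefound` (Track 2 foundations library; seat `lit-hodgefound-p34`,
generation 19, self-proposed row g19-#1 of `run/shared/lean/pub/lit-hodgefound/SKELETON.md`). Four definitions WITH BODIES
(the point group `L(H)(K)`, the character `l`, the isomorphism of Theorem 4.4, the cocharacter `w`) and THEOREMS; no named
fact (net debt `0`). Sequel of the seat's g18-#1 `Motives/HodgeStructureLefschetzGroupPoints` (Milne §1 on `K`-points: the
centraliser `C(H)`, the groups `S(H)(K) = Polarization.lefschetzGroupBaseChange` — Milne's `S(A)` — and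
`G(H)(K) = Polarization.lefschetzSimilitudeGroupBaseChange` — Milne's `G(A)`), same CARRIER: an abstract pure `ℚ`-Hodge structure
`H : HodgeStructure V n` of any weight on a finite-dimensional `V` with a polarization `Q`, `E_φ = H.endAlg`, `Q_K = Q.form.baseChange K`,
points over any field `K ⊇ ℚ`; the Mumford–Tate side is the tree's `MT(H)(K) = H.mumfordTateGroupBaseChange K`,
`Hg(H)(K) = H.hodgeGroupBaseChange K`, the multiplier character `ν = Q.multiplierChar K : MT(H)(K) →* Kˣ` (g9-#2
`Motives/MumfordTateMultiplierCharacter`), Deligne's `G(K) = H.extendedMumfordTateGroupBaseChange K ≤ GL(K ⊗ V) × Kˣ` (g11-#1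
`Motives/ExtendedMumfordTateGroup`) and `Hg(H)(K) = Ker ν` in odd weight (g11-#2 `Motives/HodgeGroupKernelMultiplierCharacter`).
The Tannaka-free complex-abelian-variety version of Milne §4 is `Literature/AlgebraicGeometry/Milne1999/LefschetzGroup` (other
carrier: `complexBetti`, model-layer hypotheses) — BY NAME, nothing of it is imported or restated.

## The source, verbatim

J. S. Milne, *Lefschetz classes on abelian varieties*, Duke Math. J. **96** (1999) 639–675 [Milne1999LefschetzClasses] (held
`paper:doi-10-1215-s0012-7094-99-09620-5`, author's folios; Duke page ≈ folio + 638), §4: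
* p0021 L1–L4 (p. 659): "**Definition 4.3.** The Lefschetz group `L(A)` of an abelian variety `A` over `Ω` is the largest algebraic
  subgroup of `GL(V(A)) × 𝔾_m/k` fixing the elements of `D^s_hom(A^r)_k ⊂ H^{2s}(A^r)(s)` for all `r, s`." (p0019–p0020:
  "`D_hom(X)_k` [is] the `k`-subspace of `H^{2*}(X)(*)` spanned by the image of the cycle class map.")
* p0021 L5–L9: "Let `G(A)` be the algebraic subgroup of `GL(V(A))` such that `G(A)(R) = {γ ∈ C(A) ⊗ R | γ†γ ∈ R^×}` for any
  `k`-algebra `R`. Thus, for any ample divisor `D` on `A`, `G(A)` is the largest algebraic subgroup of `GSp(E^D)` commuting with the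
  endomorphisms of `A`."
* p0021 L10–L20: "**Theorem 4.4.** The map `γ ↦ (γ, γ†γ): G(A) → GL(V(A)) × 𝔾_m` sends `G(A)` isomorphically onto `L(A)`.
  Proof. For any `γ ∈ G(A)(k)` and divisor `D` on `A`, `e_D(γx, γy) = e_D(x, γ†γx) = γ†γ · e_D(x, y)`, all `x, y ∈ V(A)`, and so
  `(γ, γ†γ)` fixes `e_D`. It therefore fixes the class of `D` in `H²(A)(1)`. More generally, any `γ ∈ G(A)(k^{al})` will fix all
  divisor classes on `A^r`, all `r`. This shows that `G(A) ⊂ L(A)`. For the converse, note that Theorem 3.2 implies that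
  `H^{2*}(A^r)(*)^{G(A)} = D_hom(A^r)_k` for all `r`, and so a variant of Chevalley's theorem (Deligne 1982, 3.1) implies that
  `L(A) = G(A)`."
* p0021 L28–L34: "The projection map `GL(V(A)) × 𝔾_m → 𝔾_m` defines a cocharacter of `L(A)`, which we denote `l(A)` (or just
  `l`). **The theorem shows that the kernel of `l(A)`, regarded as a subgroup of `GL(V(A))`, equals `S(A)`.** It is clear from the
  theorem that the homomorphism `a ↦ (a⁻¹, a⁻²): 𝔾_m → GL(V(A)) × 𝔾_m` takes values in `L(A)`. Therefore `L(A)` has a canonical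
  cocharacter `w`. Note that `l ∘ w = -2`."; proof of Cor. 4.7 (p0022 L1–L6): the exact rows `0 → S(A) → L(A) —l(A)→ 𝔾_m → 0`.
* p0022 L9–L20 (p. 660): "The Hodge group `Hg(A)` of `A` is defined to be the largest algebraic subgroup of `GL(V_B(A)) × 𝔾_m`
  fixing all the Hodge classes on `A` and its powers. […] Projection onto `𝔾_m` defines a canonical character of `Hg(A)`, and we
  let `Hg′(A)` denote its kernel. […] **Clearly `D_hom(A) ⊂ H(A)`, and so `L(A) ⊃ Hg(A)`.**"
* p0022 L22–L32: "**Proposition 4.8.** The following conditions on an abelian variety `A` are equivalent: (a) no power of `A`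
  supports an exotic Hodge class; (b) `Hg(A) = L(A)`; (c) `Hg′(A) = S(A)`; Proof. […] the equivalence of the second two follows
  from applying the Five Lemma to the diagram `0 → Hg′(A) → Hg(A) → 𝔾_m → 0` / `0 → S(A) → L(A) —l(A)→ 𝔾_m → 0`."
* B. Moonen, *An introduction to Mumford–Tate groups* (2004) [Moonen2004MT] (`paper:url-8e52397fca11` p0010 L39–L47), (5.2):
  "`MT♯(X) ⊂ MT(X) × 𝔾_m ⊂ CSp(V, φ) × 𝔾_m` is the graph of the multiplier character `CSp(V, φ) → 𝔾_m` restricted to `MT(X)`"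
  — Milne's `Hg(A) ⊂ GL × 𝔾_m` ("the Mumford–Tate group with its character") is, on points, the graph of `ν` on `MT(H)(K)`.
* P. Deligne, *Hodge cycles on abelian varieties*, LNM 900 (1982) I §3 [Deligne1982HodgeCycles], proof of Prop. 3.6:
  "`ψ(g₁v, g₁v') = g₂ⁿ ψ(v, v')` for `(g₁, g₂) ∈ G ⊆ GL(V) × 𝔾_m`" (the tree's
  `Polarization.baseChange_form_apply_of_mem_extendedMumfordTateGroupBaseChange`).

## Reading on this carrier, and what is PROVED (every field `K ⊇ ℚ`, every weight `n`)

"The elements of `D^1_hom(A)_k`", the divisor classes `e_D = e_{D₀} ∘ (β × 1)` (`β ∈ End⁰(A)`, `β† = β`; Milne Prop. 1.3 /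
Mumford p. 208), are read as the twists `Q(a ·, ·)` of the polarization by the Hodge endomorphisms `a ∈ E_φ` — on this carrier
EXACTLY the bilinear forms on `V` underlying a morphism of Hodge structures `H ⊗ H → ℚ(-n)` (the seat's g18-#2
`Polarization.forall_centralizer_form_apply_adjoint_tfae`; for `H = H¹(A)` of an abelian variety: the Künneth `H¹ ⊗ H¹`-components of
the divisor classes of `A × A`, by Lefschetz (1,1), among them Mumford's `Λ(D) = m^*D − p₁^*D − p₂^*D` whose class is `e_D`
read in `H¹ ⊗ H¹`, Mumford §20), and a pair
`(γ, c) ∈ GL(V(A)) × 𝔾_m` FIXES such a class `B` when `B_K(γ x, γ y) = c · B_K(x, y)` (contragredient action on `2`-forms, `c` on the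
Tate twist — the normalisation under which "`a ↦ (a⁻¹, a⁻²)` takes values in `L(A)`"). Milne's `L(A)` fixes `D^s_hom(A^r)` for ALL
`r, s` ⊇ these, so `L(A)(K) ⊆ L(H)(K)` in his setting; what is proved here is that THESE CLASSES ALONE ALREADY CUT OUT THE GRAPH OF
`γ ↦ γ†γ` ON `G(A)` (the "converse" half of Theorem 4.4 needs no Theorem 3.2 / Chevalley in degree `2`; Milne's other half,
"`G(A)` fixes all divisor classes on all powers", is his first display, proved here for the classes the carrier has).

* §1 **`Polarization.extendedLefschetzGroupBaseChange K Q ≤ GL(K ⊗ V) × Kˣ`** — `L(H)(K)`: the pairs `(γ, c)` with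
  `Q_K(a_K γ x, γ y) = c · Q_K(a_K x, y)` for all `a ∈ E_φ` (definition with body).
* §2 **Theorem 4.4** `mem_extendedLefschetzGroupBaseChange_iff : (γ, c) ∈ L(H)(K) ↔ γ` commutes with `E_φ ⊗ K ∧ Q_K(γ x, γ y) = c Q_K(x, y)`
  (i.e. `γ ∈ G(H)(K)` with `γ†γ = c`: `⟸` is Milne's display; `⟹`: `a = 1` gives the multiplier, then non-degeneracy of `Q_K`);
  the first projection maps `L(H)(K)` ONTO `G(H)(K)` (`map_fst_extendedLefschetzGroupBaseChange`) and is injective on it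
  (`eq_of_mem_extendedLefschetzGroupBaseChange_of_fst_eq`, `V ≠ 0`).
* §3 **"the kernel of `l(A)` […] equals `S(A)`"**: `mk_one_mem_extendedLefschetzGroupBaseChange_iff : (γ, 1) ∈ L(H)(K) ↔ γ ∈ S(H)(K)`,
  `comap_inl_extendedLefschetzGroupBaseChange`, `snd_eq_one_iff_fst_mem_lefschetzGroupBaseChange`; `L ≤ G × Kˣ`;
  **independence of the polarization** `extendedLefschetzGroupBaseChange_eq_of_polarization`.
* §4 **`w`**: `(a · id, a²) ∈ L(H)(K)`, **`(a⁻¹ · id, a⁻²) ∈ L(H)(K)`**, the homomorphism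
  `Polarization.lefschetzWeightCocharacter K Q : Kˣ →* L(H)(K)` (definition with body) and **"`l ∘ w = -2`"**
  (`snd_lefschetzWeightCocharacter_apply`).
* §5 **`l(A)` as `γ ↦ γ†γ` on `G(A)`** (`V ≠ 0`): `Polarization.lefschetzMultiplier K Q : G(H)(K) →* Kˣ` (definition with body),
  `Q_K(γ x, γ y) = l(γ) Q_K(x, y)`, uniqueness, `l(a · id) = a²`, **`Ker l = S(H)(K)`** (`ker_lefschetzMultiplier`), `l|_{MT(H)(K)} = ν`
  (`lefschetzMultiplier_eq_multiplierChar`), `l` independent of `Q`; and **Theorem 4.4 as a group isomorphism**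
  `Polarization.lefschetzSimilitudeGroupBaseChangeMulEquiv K Q : G(H)(K) ≃* L(H)(K)`, `γ ↦ (γ, l(γ))`, inverse the first projection.
* §6 **"`L(A) ⊃ Hg(A)`"**: `(γ, ν(γ)) ∈ L(H)(K)` for `γ ∈ MT(H)(K)` (`mk_multiplierChar_mem_extendedLefschetzGroupBaseChange`,
  `range_prod_multiplierChar_le_extendedLefschetzGroupBaseChange` — Moonen's graph of `ν`), and in Deligne's normalisation
  `(g, ν) ∈ G(K) ⟹ (g, νⁿ) ∈ L(H)(K)` (`mk_zpow_mem_extendedLefschetzGroupBaseChange_of_mem`); `Hg(H)(K) × 1 ≤ L(H)(K)`.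
* §7 **Proposition 4.8 (b) ⇔ (c) on points**, odd weight, `V ≠ 0`: `MT(H)(K) = G(H)(K) ⟹ Hg(H)(K) = S(H)(K)` (every `K`;
  `Hg = Ker ν`, `S = Ker l`); the converse for `K` with all elements squares (`d⁻¹γ ∈ S(H)(K)` for `γ ∈ G(H)(K)` of multiplier `d²`,
  homotheties in `MT(H)(K)`), hence **`Hg(H)(K) = S(H)(K) ↔ MT(H)(K) = G(H)(K)` for `K` algebraically closed**
  (`hodgeGroupBaseChange_eq_lefschetzGroupBaseChange_iff`); and (b) literally inside `GL × Kˣ`: the graph of `ν` on `MT(H)(K)`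
  EQUALS `L(H)(K)` iff `MT(H)(K) = G(H)(K)` (`range_prod_multiplierChar_eq_extendedLefschetzGroupBaseChange_iff`).

NOT here (scope, so as not to over-claim): `L(A)` as an algebraic group / scheme over `k` and the classes `D^s_hom(A^r)` for
`s > 1` or on powers `A^r` (the carrier has no cycle class map; the tree's point groups are one abstract subgroup per field `K`);
Theorem 3.2 and the Chevalley argument; Corollary 4.5 beyond degree `2` (in degree `2` it is the seat's g18-#2/#8: the
`S(H)(K)`-invariant forms are the `E_φ ⊗ K`-twists); Corollary 4.7 (products; the `S`-level is the seat's g18-#4/#5);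
Proposition 4.8 (a) (exotic classes) and 4.8 as a statement about algebraic groups (only the point-group implications above;
in even weight `≠ 0` the tree's `Hg(H)(K)` is NOT `Ker ν`, `Motives/HodgeGroupKernelMultiplierCharacter` §4, so §7 is stated for
odd weight — the abelian-variety case `n = ∓1`); the reading of `L(H)(K)` through morphisms `H ⊗ H → ℚ(-n)` (a sequel file, with
g18-#2). Milne's `R`-points for non-field `k`-algebras `R` are not formed.

## References

* [Milne1999LefschetzClasses] J. S. Milne, *Lefschetz classes on abelian varieties*, Duke Math. J. 96 (1999) 639–675, §4:
  Definition 4.3, Theorem 4.4 with proof, the cocharacters `l(A)` and `w` (p. 659), `L(A) ⊃ Hg(A)` and Proposition 4.8 (p. 660).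
* [Moonen2004MT] B. Moonen, *An introduction to Mumford–Tate groups* (2004), (5.2) (the graph of the multiplier character), (5.8).
* [Deligne1982HodgeCycles] P. Deligne, *Hodge cycles on abelian varieties*, LNM 900 (1982), I §3, proof of Prop. 3.6.
* [Lange2023AbelianVarietiesComplex] H. Lange, *Abelian Varieties over the Complex Numbers* (2023), §7.2.4 Exercise (4) (a), (b)
  (independence of the polarization; `Lf ⊇ Hg`).
* [MumfordAV1970] D. Mumford, *Abelian Varieties* (1970), §20 (the Riemann form `e_D` of `Λ(D) = m^*D − p₁^*D − p₂^*D`) and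
  Application III p. 208 (through Milne §1).
-/

noncomputable section

open scoped TensorProduct

namespace Literature.AlgebraicGeometry.Motives

namespace HodgeStructure

universe u uK

variable {V : Type u} [AddCommGroup V] [Module ℚ V] {n : ℤ} {H : HodgeStructure V n}

/-! ## §1 The group `L(H)(K) ≤ GL(K ⊗ V) × Kˣ` of pairs fixing the divisor classes -/

section Definition

variable (K : Type uK) [Field K] [Algebra ℚ K]

/-- An automorphism and its inverse in `GL(W)`: `γ (γ⁻¹ x) = x`. [folklore] -/
private theorem gl_apply_inv_apply' {R : Type*} [CommSemiring R] {W : Type*} [AddCommMonoid W] [Module R W]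
    (γ : W ≃ₗ[R] W) (x : W) : γ (γ⁻¹ x) = x :=
  γ.apply_symm_apply x

/-- **Milne's Lefschetz group `L(A) ⊂ GL(V(A)) × 𝔾_m` (Definition 4.3), on `K`-points of a polarized `ℚ`-Hodge structure
`(H, Q)`, read on the degree-`2` classes**: the subgroup of `GL(K ⊗_ℚ V) × Kˣ` of the pairs `(γ, c)` FIXING EVERY DIVISOR
CLASS — every form `e_D = e_{D₀} ∘ (β × 1)`, i.e. here every twist `Q(a ·, ·)` of the polarization by a Hodge endomorphism
`a ∈ E_φ = End_HS(H)` (Milne: "`D_hom(A)_k` [is] the `k`-subspace spanned by the image of the cycle class map", and by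
Prop. 1.3 / Mumford p. 208 these are the `e_{D₀} ∘ (β × 1)`, `β ∈ End⁰(A)`; on this carrier EXACTLY the bilinear forms
underlying a morphism `H ⊗ H → ℚ(-n)`, the seat's g18-#2 `Polarization.forall_centralizer_form_apply_adjoint_tfae`) — where
`(γ, c)` fixes the class `B` when `B_K(γ x, γ y) = c · B_K(x, y)` (`γ` acting on `2`-forms contragrediently and `c ∈ 𝔾_m` on the
Tate twist,
so that "`a ↦ (a⁻¹, a⁻²)` takes values in `L(A)`"). "The Lefschetz group `L(A)` of an abelian variety `A` over `Ω` is the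
largest algebraic subgroup of `GL(V(A)) × 𝔾_m` fixing the elements of `D^s_hom(A^r)_k ⊂ H^{2s}(A^r)(s) for all r, s`": here
`s = 1` and the classes of `H ⊗ H` (for an abelian variety: the divisor classes of `A × A` in `H¹ ⊗ H¹ ⊂ H²(A²)`), which by
Theorem 4.4 (`mem_extendedLefschetzGroupBaseChange_iff`) already cut out the graph of `γ ↦ γ†γ` on `G(A)`.
[cite: Milne1999LefschetzClasses, §4 Definition 4.3 and Theorem 4.4 (p. 659)] -/
def Polarization.extendedLefschetzGroupBaseChange (Q : Polarization H) :
    Subgroup (((K ⊗[ℚ] V) ≃ₗ[K] (K ⊗[ℚ] V)) × Kˣ) where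
  carrier := {p | ∀ a : H.endAlg, ∀ x y,
    Q.form.baseChange K ((a : Module.End ℚ V).baseChange K (p.1 x)) (p.1 y) =
      (p.2 : K) * Q.form.baseChange K ((a : Module.End ℚ V).baseChange K x) y}
  one_mem' a x y := by
    rw [Prod.snd_one, Units.val_one, one_mul]
    rfl
  mul_mem' {p q} hp hq a x y := by
    rw [Prod.fst_mul, Prod.snd_mul, LinearEquiv.mul_apply, LinearEquiv.mul_apply, hp a, hq a, Units.val_mul, mul_assoc]
  inv_mem' {p} hp a x y := by
    have h := hp a (p.1⁻¹ x) (p.1⁻¹ y)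
    rw [gl_apply_inv_apply', gl_apply_inv_apply'] at h
    rw [Prod.fst_inv, Prod.snd_inv, Units.val_inv_eq_inv_val, eq_inv_mul_iff_mul_eq₀ p.2.ne_zero]
    exact h.symm

variable {K} in
/-- Membership in `L(H)(K)`: `(γ, c)` fixes every divisor class `Q(a ·, ·)`, `a ∈ E_φ`:
`Q_K(a_K γ x, γ y) = c · Q_K(a_K x, y)`. [cite: Milne1999LefschetzClasses, §4 Definition 4.3 (p. 659)] -/
theorem Polarization.mem_extendedLefschetzGroupBaseChange_iff' (Q : Polarization H)
    (p : ((K ⊗[ℚ] V) ≃ₗ[K] (K ⊗[ℚ] V)) × Kˣ) :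
    p ∈ Q.extendedLefschetzGroupBaseChange K ↔ ∀ a : H.endAlg, ∀ x y,
      Q.form.baseChange K ((a : Module.End ℚ V).baseChange K (p.1 x)) (p.1 y) =
        (p.2 : K) * Q.form.baseChange K ((a : Module.End ℚ V).baseChange K x) y :=
  Iff.rfl

end Definition

/-! ## §2 Theorem 4.4: `(γ, c) ∈ L(H)(K)` iff `γ ∈ G(H)(K)` with `γ†γ = c` -/

section TheoremFourFour

variable (K : Type uK) [Field K] [Algebra ℚ K] [Module.Finite ℚ V] (Q : Polarization H)

variable {K} in
/-- Non-degeneracy of `Q_K` against a surjective `γ`: if `Q_K(u, γ y) = 0` for all `y` then `u = 0`. [folklore] -/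
private theorem eq_zero_of_forall_baseChange_form_apply_eq_zero (γ : (K ⊗[ℚ] V) ≃ₗ[K] (K ⊗[ℚ] V)) {u : K ⊗[ℚ] V}
    (hu : ∀ y, Q.form.baseChange K u (γ y) = 0) : u = 0 :=
  (Literature.Algebra.Lie.KillingBaseChange.nondegenerate_baseChange (K := K) Q.nondegenerate).1 u fun z ↦ by
    simpa only [gl_apply_inv_apply'] using hu (γ⁻¹ z)

variable {K} in
/-- **Theorem 4.4 (Milne 1999), on `K`-points: "The map `γ ↦ (γ, γ†γ) : G(A) → GL(V(A)) × 𝔾_m` sends `G(A)` isomorphically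
onto `L(A)`"** — membership form: `(γ, c)` fixes every divisor class iff `γ` COMMUTES WITH `E_φ ⊗ K` and is a SIMILITUDE of
`Q_K` WITH MULTIPLIER `c` ("`e_D(γx, γy) = e_D(x, γ†γx) = γ†γ · e_D(x, y)`" gives `⟸`; for `⟹`, `a = 1` gives the multiplier,
and then `Q_K(a_K γ x, γ y) = c Q_K(a_K x, y) = Q_K(γ a_K x, γ y)` for all `y` forces `a_K γ = γ a_K` because `Q_K` is
non-degenerate and `γ` is onto). [cite: Milne1999LefschetzClasses, §4 Theorem 4.4 (p. 659)] -/
theorem Polarization.mem_extendedLefschetzGroupBaseChange_iff (p : ((K ⊗[ℚ] V) ≃ₗ[K] (K ⊗[ℚ] V)) × Kˣ) :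
    p ∈ Q.extendedLefschetzGroupBaseChange K ↔
      (∀ a : H.endAlg, ∀ x, (a : Module.End ℚ V).baseChange K (p.1 x) = p.1 ((a : Module.End ℚ V).baseChange K x)) ∧
        ∀ x y, Q.form.baseChange K (p.1 x) (p.1 y) = (p.2 : K) * Q.form.baseChange K x y := by
  constructor
  · intro hp
    have hsim : ∀ x y, Q.form.baseChange K (p.1 x) (p.1 y) = (p.2 : K) * Q.form.baseChange K x y := fun x y ↦ by
      have h := hp 1 x y
      rwa [OneMemClass.coe_one, LinearMap.baseChange_one, Module.End.one_apply, Module.End.one_apply] at h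
    refine ⟨fun a x ↦ ?_, hsim⟩
    rw [← sub_eq_zero]
    refine eq_zero_of_forall_baseChange_form_apply_eq_zero Q p.1 fun y ↦ ?_
    rw [LinearMap.map_sub₂, hp a x y, hsim, sub_self]
  · rintro ⟨hcomm, hsim⟩ a x y
    rw [hcomm a x, hsim]

variable {K} in
/-- Theorem 4.4, first projection: `(γ, c) ∈ L(H)(K) ⟹ γ ∈ G(H)(K)` (Milne's `G(A)(K) = {γ ∈ C(A) ⊗ K | γ†γ ∈ K^×}`, the
tree's `Polarization.lefschetzSimilitudeGroupBaseChange`). [cite: Milne1999LefschetzClasses, §4 Theorem 4.4 (p. 659)] -/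
theorem Polarization.fst_mem_lefschetzSimilitudeGroupBaseChange_of_mem {p : ((K ⊗[ℚ] V) ≃ₗ[K] (K ⊗[ℚ] V)) × Kˣ}
    (hp : p ∈ Q.extendedLefschetzGroupBaseChange K) : p.1 ∈ Q.lefschetzSimilitudeGroupBaseChange K := by
  obtain ⟨hcomm, hsim⟩ := (Q.mem_extendedLefschetzGroupBaseChange_iff p).1 hp
  exact ⟨hcomm, p.2, p.2.ne_zero, hsim⟩

variable {K} in
/-- Theorem 4.4, the multiplier: for `(γ, c) ∈ L(H)(K)`, `Q_K(γ x, γ y) = c · Q_K(x, y)` ("`e_D(γx, γy) = γ†γ · e_D(x, y)`",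
`c = γ†γ`). [cite: Milne1999LefschetzClasses, §4 Theorem 4.4 (p. 659)] -/
theorem Polarization.baseChange_form_apply_apply_of_mem_extendedLefschetzGroupBaseChange
    {p : ((K ⊗[ℚ] V) ≃ₗ[K] (K ⊗[ℚ] V)) × Kˣ} (hp : p ∈ Q.extendedLefschetzGroupBaseChange K) (x y : K ⊗[ℚ] V) :
    Q.form.baseChange K (p.1 x) (p.1 y) = (p.2 : K) * Q.form.baseChange K x y :=
  ((Q.mem_extendedLefschetzGroupBaseChange_iff p).1 hp).2 x y

variable {K} in
/-- Theorem 4.4, surjectivity: every `γ ∈ G(H)(K)` with `Q_K(γ x, γ y) = c Q_K(x, y)` gives `(γ, c) ∈ L(H)(K)` ("any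
`γ ∈ G(A)(k^{al})` will fix all divisor classes […] This shows that `G(A) ⊂ L(A)`"). [cite: Milne1999LefschetzClasses, §4 Theorem 4.4 (proof, p. 659)] -/
theorem Polarization.mk_mem_extendedLefschetzGroupBaseChange_of_mem {γ : (K ⊗[ℚ] V) ≃ₗ[K] (K ⊗[ℚ] V)}
    (hγ : γ ∈ Q.lefschetzSimilitudeGroupBaseChange K) {c : Kˣ}
    (hc : ∀ x y, Q.form.baseChange K (γ x) (γ y) = (c : K) * Q.form.baseChange K x y) :
    (γ, c) ∈ Q.extendedLefschetzGroupBaseChange K :=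
  (Q.mem_extendedLefschetzGroupBaseChange_iff (γ, c)).2 ⟨hγ.1, hc⟩

variable {K} in
/-- Theorem 4.4, surjectivity in `∃`-form: every `γ ∈ G(H)(K)` is the first component of some `(γ, c) ∈ L(H)(K)`.
[cite: Milne1999LefschetzClasses, §4 Theorem 4.4 (p. 659)] -/
theorem Polarization.exists_mk_mem_extendedLefschetzGroupBaseChange_of_mem {γ : (K ⊗[ℚ] V) ≃ₗ[K] (K ⊗[ℚ] V)}
    (hγ : γ ∈ Q.lefschetzSimilitudeGroupBaseChange K) : ∃ c : Kˣ, (γ, c) ∈ Q.extendedLefschetzGroupBaseChange K := by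
  obtain ⟨ν, hν, h⟩ := hγ.2
  exact ⟨Units.mk0 ν hν, Q.mk_mem_extendedLefschetzGroupBaseChange_of_mem hγ fun x y ↦ by rw [Units.val_mk0, h]⟩

/-- **Theorem 4.4, "onto": the first projection maps `L(H)(K)` ONTO `G(H)(K)`.** [cite: Milne1999LefschetzClasses, §4 Theorem 4.4 (p. 659)] -/
theorem Polarization.map_fst_extendedLefschetzGroupBaseChange :
    (Q.extendedLefschetzGroupBaseChange K).map (MonoidHom.fst _ _) = Q.lefschetzSimilitudeGroupBaseChange K := by
  refine le_antisymm ?_ fun γ hγ ↦ ?_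
  · rintro _ ⟨p, hp, rfl⟩
    exact Q.fst_mem_lefschetzSimilitudeGroupBaseChange_of_mem hp
  · obtain ⟨c, hc⟩ := Q.exists_mk_mem_extendedLefschetzGroupBaseChange_of_mem hγ
    exact ⟨(γ, c), hc, rfl⟩

variable {K} in
/-- **Theorem 4.4, "injective": the first projection is injective on `L(H)(K)`** — the multiplier `c = γ†γ` of
`(γ, c) ∈ L(H)(K)` is determined by `γ` (`Q_K ≠ 0` for `V ≠ 0`). [cite: Milne1999LefschetzClasses, §4 Theorem 4.4 (p. 659)] -/
theorem Polarization.snd_eq_snd_of_mem_extendedLefschetzGroupBaseChange [Nontrivial V]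
    {p q : ((K ⊗[ℚ] V) ≃ₗ[K] (K ⊗[ℚ] V)) × Kˣ} (hp : p ∈ Q.extendedLefschetzGroupBaseChange K)
    (hq : q ∈ Q.extendedLefschetzGroupBaseChange K) (h : p.1 = q.1) : p.2 = q.2 := by
  refine Units.ext (Q.similitudeFactor_unique K (γ := p.1)
    (Q.baseChange_form_apply_apply_of_mem_extendedLefschetzGroupBaseChange hp) fun x y ↦ ?_)
  rw [h]
  exact Q.baseChange_form_apply_apply_of_mem_extendedLefschetzGroupBaseChange hq x y

variable {K} in
/-- Theorem 4.4, "injective", as equality of pairs. [cite: Milne1999LefschetzClasses, §4 Theorem 4.4 (p. 659)] -/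
theorem Polarization.eq_of_mem_extendedLefschetzGroupBaseChange_of_fst_eq [Nontrivial V]
    {p q : ((K ⊗[ℚ] V) ≃ₗ[K] (K ⊗[ℚ] V)) × Kˣ} (hp : p ∈ Q.extendedLefschetzGroupBaseChange K)
    (hq : q ∈ Q.extendedLefschetzGroupBaseChange K) (h : p.1 = q.1) : p = q :=
  Prod.ext h (Q.snd_eq_snd_of_mem_extendedLefschetzGroupBaseChange hp hq h)

end TheoremFourFour

/-! ## §3 `Ker l(A) = S(A)`; `L ≤ G × 𝔾_m`; independence of the polarization -/

section Kernel

variable (K : Type uK) [Field K] [Algebra ℚ K] [Module.Finite ℚ V] (Q : Polarization H)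

variable {K} in
/-- **"The theorem shows that the kernel of `l(A)`, regarded as a subgroup of `GL(V(A))`, equals `S(A)`"** (`l(A)` = the
projection `GL(V(A)) × 𝔾_m → 𝔾_m` restricted to `L(A)`), on `K`-points: `(γ, 1) ∈ L(H)(K)` iff `γ ∈ S(H)(K)` — the pairs with
trivial multiplier are exactly the elements of Milne's `S(A)(K) = {γ ∈ C(A) ⊗ K | γ†γ = 1}` (the tree's
`Polarization.lefschetzGroupBaseChange`). [cite: Milne1999LefschetzClasses, §4 p. 659 L28–L31 (after Corollary 4.5)] -/
theorem Polarization.mk_one_mem_extendedLefschetzGroupBaseChange_iff (γ : (K ⊗[ℚ] V) ≃ₗ[K] (K ⊗[ℚ] V)) :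
    (γ, (1 : Kˣ)) ∈ Q.extendedLefschetzGroupBaseChange K ↔ γ ∈ Q.lefschetzGroupBaseChange K := by
  rw [Q.mem_extendedLefschetzGroupBaseChange_iff, Q.mem_lefschetzGroupBaseChange_iff]
  simp only [Units.val_one, one_mul]

/-- `Ker l = S` as subgroups: the pull-back of `L(H)(K)` along `γ ↦ (γ, 1)` is `S(H)(K)`.
[cite: Milne1999LefschetzClasses, §4 p. 659 L28–L31] -/
theorem Polarization.comap_inl_extendedLefschetzGroupBaseChange :
    (Q.extendedLefschetzGroupBaseChange K).comap (MonoidHom.inl _ Kˣ) = Q.lefschetzGroupBaseChange K := by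
  ext γ
  rw [Subgroup.mem_comap, MonoidHom.inl_apply]
  exact Q.mk_one_mem_extendedLefschetzGroupBaseChange_iff γ

variable {K} in
/-- For `(γ, c) ∈ L(H)(K)` with `c = 1`: `γ ∈ S(H)(K)`. [cite: Milne1999LefschetzClasses, §4 p. 659 L28–L31] -/
theorem Polarization.fst_mem_lefschetzGroupBaseChange_of_mem_of_snd_eq_one {p : ((K ⊗[ℚ] V) ≃ₗ[K] (K ⊗[ℚ] V)) × Kˣ}
    (hp : p ∈ Q.extendedLefschetzGroupBaseChange K) (h1 : p.2 = 1) : p.1 ∈ Q.lefschetzGroupBaseChange K := by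
  rw [← Q.mk_one_mem_extendedLefschetzGroupBaseChange_iff p.1, ← h1]
  exact hp

variable {K} in
/-- For `(γ, c) ∈ L(H)(K)` (`V ≠ 0`): `c = 1` iff `γ ∈ S(H)(K)` — the exactness of `0 → S(A) → L(A) —l(A)→ 𝔾_m` at `L(A)`,
on points. [cite: Milne1999LefschetzClasses, §4 p. 659 L28–L31 and proof of Cor. 4.7 (p. 660)] -/
theorem Polarization.snd_eq_one_iff_fst_mem_lefschetzGroupBaseChange [Nontrivial V] {p : ((K ⊗[ℚ] V) ≃ₗ[K] (K ⊗[ℚ] V)) × Kˣ}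
    (hp : p ∈ Q.extendedLefschetzGroupBaseChange K) : p.2 = 1 ↔ p.1 ∈ Q.lefschetzGroupBaseChange K := by
  refine ⟨Q.fst_mem_lefschetzGroupBaseChange_of_mem_of_snd_eq_one hp, fun h ↦ ?_⟩
  have h' : (p.1, (1 : Kˣ)) ∈ Q.extendedLefschetzGroupBaseChange K :=
    (Q.mk_one_mem_extendedLefschetzGroupBaseChange_iff p.1).2 h
  exact Q.snd_eq_snd_of_mem_extendedLefschetzGroupBaseChange hp h' rfl

/-- `S(H)(K) × {1} ≤ L(H)(K)`. [cite: Milne1999LefschetzClasses, §4 p. 659 L28–L31] -/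
theorem Polarization.prod_lefschetzGroupBaseChange_bot_le :
    (Q.lefschetzGroupBaseChange K).prod ⊥ ≤ Q.extendedLefschetzGroupBaseChange K := by
  rintro ⟨γ, c⟩ ⟨hγ, hc⟩
  obtain rfl : c = 1 := (Subgroup.mem_bot).1 hc
  exact (Q.mk_one_mem_extendedLefschetzGroupBaseChange_iff γ).2 hγ

/-- `L(H)(K) ≤ G(H)(K) × Kˣ` (the first projection lands in `G(A)`). [cite: Milne1999LefschetzClasses, §4 Theorem 4.4 (p. 659)] -/
theorem Polarization.extendedLefschetzGroupBaseChange_le_prod :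
    Q.extendedLefschetzGroupBaseChange K ≤ (Q.lefschetzSimilitudeGroupBaseChange K).prod ⊤ := fun _ hp ↦
  ⟨Q.fst_mem_lefschetzSimilitudeGroupBaseChange_of_mem hp, Subgroup.mem_top _⟩

variable [HodgeTensorFacts.{u, u}]

/-- **`L(H)(K)` does not depend on the polarization** (Milne: `L(A)` is defined by the divisor classes alone; here: a `γ`
commuting with `E_φ ⊗ K` multiplies every polarization by the same scalar, the tree's
`Polarization.baseChange_form_apply_apply_eq_mul_of_forall_endAlg_comm`, and `G(H)(K)` is independent of `Q`).
[cite: Milne1999LefschetzClasses, §4 Definition 4.3 and Theorem 4.4 (p. 659)] [cite: Lange2023AbelianVarietiesComplex, §7.2.4 Exercise (4) (a)] -/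
theorem Polarization.extendedLefschetzGroupBaseChange_eq_of_polarization (Q Q' : Polarization H) :
    Q.extendedLefschetzGroupBaseChange K = Q'.extendedLefschetzGroupBaseChange K := by
  suffices h : ∀ Q Q' : Polarization H, Q.extendedLefschetzGroupBaseChange K ≤ Q'.extendedLefschetzGroupBaseChange K from
    le_antisymm (h Q Q') (h Q' Q)
  intro Q Q' p hp
  obtain ⟨hcomm, hsim⟩ := (Q.mem_extendedLefschetzGroupBaseChange_iff p).1 hp
  exact (Q'.mem_extendedLefschetzGroupBaseChange_iff p).2
    ⟨hcomm, Q.baseChange_form_apply_apply_eq_mul_of_forall_endAlg_comm K Q' (γ := (p.1 : Module.End K (K ⊗[ℚ] V))) hcomm hsim⟩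

end Kernel

/-! ## §4 The canonical cocharacter `w : a ↦ (a⁻¹, a⁻²)` and the scalars -/

section WeightCocharacter

variable (K : Type uK) [Field K] [Algebra ℚ K] (Q : Polarization H)

/-- The homothety `a · id` with the multiplier `a²`: `(a · id, a²) ∈ L(H)(K)` (`Q_K(a x, a y) = a² Q_K(x, y)` and `a · id`
commutes with everything). [cite: Milne1999LefschetzClasses, §4 p. 659 L31–L34] -/
theorem Polarization.smulOfUnit_mem_extendedLefschetzGroupBaseChange (a : Kˣ) :
    (LinearEquiv.smulOfUnit a, a * a) ∈ Q.extendedLefschetzGroupBaseChange K := by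
  intro b x y
  change Q.form.baseChange K ((b : Module.End ℚ V).baseChange K (a • x)) (a • y) =
    ((a * a : Kˣ) : K) * Q.form.baseChange K ((b : Module.End ℚ V).baseChange K x) y
  simp only [Units.smul_def, LinearMap.map_smul, LinearMap.smul_apply, smul_eq_mul, Units.val_mul]
  ring

/-- **"It is clear from the theorem that the homomorphism `a ↦ (a⁻¹, a⁻²) : 𝔾_m → GL(V(A)) × 𝔾_m` takes values in `L(A)`"**,
on `K`-points: `(a⁻¹ · id, a⁻²) ∈ L(H)(K)` for every `a ∈ Kˣ`. [cite: Milne1999LefschetzClasses, §4 p. 659 L31–L34] -/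
theorem Polarization.smulOfUnit_inv_mem_extendedLefschetzGroupBaseChange (a : Kˣ) :
    (LinearEquiv.smulOfUnit a⁻¹, a ^ (-2 : ℤ)) ∈ Q.extendedLefschetzGroupBaseChange K := by
  have h : a ^ (-2 : ℤ) = a⁻¹ * a⁻¹ := by
    rw [show (-2 : ℤ) = -1 + -1 by norm_num, zpow_add, zpow_neg_one]
  rw [h]
  exact Q.smulOfUnit_mem_extendedLefschetzGroupBaseChange K a⁻¹

/-- `a · id` acts on `K ⊗ V` multiplicatively in `a`: `(a b) · x = a · (b · x)` as automorphisms. [folklore] -/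
private theorem smulOfUnit_mul' (a b : Kˣ) :
    (LinearEquiv.smulOfUnit (a * b) : (K ⊗[ℚ] V) ≃ₗ[K] (K ⊗[ℚ] V)) = LinearEquiv.smulOfUnit a * LinearEquiv.smulOfUnit b :=
  LinearEquiv.ext fun x ↦ mul_smul a b x

/-- `1 · id = id` as automorphisms of `K ⊗ V`. [folklore] -/
private theorem smulOfUnit_one' : (LinearEquiv.smulOfUnit 1 : (K ⊗[ℚ] V) ≃ₗ[K] (K ⊗[ℚ] V)) = 1 :=
  LinearEquiv.ext fun x ↦ one_smul Kˣ x

/-- `(a · id) (a⁻¹ · id) γ = γ` in `GL(K ⊗ V)`. [folklore] -/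
private theorem smulOfUnit_mul_smulOfUnit_inv_mul (a : Kˣ) (γ : (K ⊗[ℚ] V) ≃ₗ[K] (K ⊗[ℚ] V)) :
    LinearEquiv.smulOfUnit a * (LinearEquiv.smulOfUnit a⁻¹ * γ) = γ := by
  rw [← mul_assoc, ← smulOfUnit_mul', mul_inv_cancel, smulOfUnit_one', one_mul]

/-- **Milne's canonical cocharacter `w` of `L(A)`** ("Therefore `L(A)` has a canonical cocharacter `w`"), on `K`-points: the
homomorphism `a ↦ (a⁻¹ · id, a⁻²) : Kˣ → L(H)(K)`. [cite: Milne1999LefschetzClasses, §4 p. 659 L31–L34] -/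
def Polarization.lefschetzWeightCocharacter : Kˣ →* Q.extendedLefschetzGroupBaseChange K where
  toFun a := ⟨(LinearEquiv.smulOfUnit a⁻¹, a ^ (-2 : ℤ)), Q.smulOfUnit_inv_mem_extendedLefschetzGroupBaseChange K a⟩
  map_one' := Subtype.ext <|
    show ((LinearEquiv.smulOfUnit (1 : Kˣ)⁻¹ : (K ⊗[ℚ] V) ≃ₗ[K] (K ⊗[ℚ] V)), (1 : Kˣ) ^ (-2 : ℤ)) = 1 by
      rw [inv_one, smulOfUnit_one', one_zpow]; rfl
  map_mul' a b := Subtype.ext <|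
    show ((LinearEquiv.smulOfUnit (a * b)⁻¹ : (K ⊗[ℚ] V) ≃ₗ[K] (K ⊗[ℚ] V)), (a * b) ^ (-2 : ℤ)) =
        ((LinearEquiv.smulOfUnit a⁻¹ : (K ⊗[ℚ] V) ≃ₗ[K] (K ⊗[ℚ] V)), a ^ (-2 : ℤ)) *
          ((LinearEquiv.smulOfUnit b⁻¹ : (K ⊗[ℚ] V) ≃ₗ[K] (K ⊗[ℚ] V)), b ^ (-2 : ℤ)) by
      rw [Prod.mk_mul_mk, mul_inv, smulOfUnit_mul', mul_zpow]

/-- `w(a) = (a⁻¹ · id, a⁻²)`. [cite: Milne1999LefschetzClasses, §4 p. 659 L31–L34] -/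
theorem Polarization.coe_lefschetzWeightCocharacter_apply (a : Kˣ) :
    ((Q.lefschetzWeightCocharacter K a : Q.extendedLefschetzGroupBaseChange K) : ((K ⊗[ℚ] V) ≃ₗ[K] (K ⊗[ℚ] V)) × Kˣ) =
      (LinearEquiv.smulOfUnit a⁻¹, a ^ (-2 : ℤ)) :=
  rfl

/-- **"Note that `l ∘ w = -2`"**: the `𝔾_m`-component of `w(a)` is `a⁻²`. [cite: Milne1999LefschetzClasses, §4 p. 659 L34] -/
theorem Polarization.snd_lefschetzWeightCocharacter_apply (a : Kˣ) :
    ((Q.lefschetzWeightCocharacter K a : Q.extendedLefschetzGroupBaseChange K) : ((K ⊗[ℚ] V) ≃ₗ[K] (K ⊗[ℚ] V)) × Kˣ).2 =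
      a ^ (-2 : ℤ) :=
  rfl

/-- `w(a)` acts on `K ⊗ V` as `a⁻¹ · id`. [cite: Milne1999LefschetzClasses, §4 p. 659 L31–L34] -/
theorem Polarization.fst_lefschetzWeightCocharacter_apply_apply (a : Kˣ) (x : K ⊗[ℚ] V) :
    ((Q.lefschetzWeightCocharacter K a : Q.extendedLefschetzGroupBaseChange K) : ((K ⊗[ℚ] V) ≃ₗ[K] (K ⊗[ℚ] V)) × Kˣ).1 x =
      a⁻¹ • x :=
  rfl

end WeightCocharacter

/-! ## §5 The character `l(A) : γ ↦ γ†γ` on `G(A)` and Theorem 4.4 as an isomorphism of groups `G(H)(K) ≃* L(H)(K)` -/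

section Multiplier

variable (K : Type uK) [Field K] [Algebra ℚ K] [Nontrivial V] (Q : Polarization H)

variable {K} in
omit [Nontrivial V] in
/-- The multiplier of an element of `G(H)(K)` exists (part of the definition). [cite: Milne1999LefschetzClasses, §4 p. 659 L10–L14] -/
private theorem Polarization.exists_multiplier_of_mem (γ : Q.lefschetzSimilitudeGroupBaseChange K) :
    ∃ ν : K, ν ≠ 0 ∧ ∀ x y, Q.form.baseChange K ((γ : (K ⊗[ℚ] V) ≃ₗ[K] (K ⊗[ℚ] V)) x)
      ((γ : (K ⊗[ℚ] V) ≃ₗ[K] (K ⊗[ℚ] V)) y) = ν * Q.form.baseChange K x y :=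
  ((Q.mem_lefschetzSimilitudeGroupBaseChange_iff _).1 γ.2).2

/-- **Milne's `l(A)` composed with Theorem 4.4, i.e. the character `γ ↦ γ†γ : G(A) → 𝔾_m`, on `K`-points** (`V ≠ 0`): the
multiplier `l(γ) ∈ Kˣ` of `γ ∈ G(H)(K)`, THE scalar with `Q_K(γ x, γ y) = l(γ) · Q_K(x, y)` ("`e_D(γx, γy) = e_D(x, γ†γ y) =
γ†γ · e_D(x, y)`"; unique because `Q_K ≠ 0` for `V ≠ 0`, the tree's `Polarization.similitudeFactor_unique`). Its kernel is
`S(H)(K)` (`lefschetzMultiplier_eq_one_iff`), it restricts to the multiplier character `ν` of the tree on `MT(H)(K) ≤ G(H)(K)`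
(`lefschetzMultiplier_eq_multiplierChar`), and it does not depend on `Q` (`lefschetzMultiplier_eq_of_polarization`).
[cite: Milne1999LefschetzClasses, §4 Theorem 4.4 and p. 659 L28–L31 (the cocharacter l(A))] -/
def Polarization.lefschetzMultiplier : Q.lefschetzSimilitudeGroupBaseChange K →* Kˣ where
  toFun γ := Units.mk0 (Classical.choose (Q.exists_multiplier_of_mem γ)) (Classical.choose_spec (Q.exists_multiplier_of_mem γ)).1
  map_one' := by
    refine Units.ext ?_
    rw [Units.val_mk0, Units.val_one]
    refine Q.similitudeFactor_unique K (γ := 1) (Classical.choose_spec (Q.exists_multiplier_of_mem 1)).2 fun x y ↦ ?_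
    rw [one_mul]
    rfl
  map_mul' γ γ' := by
    refine Units.ext ?_
    rw [Units.val_mk0, Units.val_mul, Units.val_mk0, Units.val_mk0]
    refine Q.similitudeFactor_unique K (γ := ((γ * γ' : Q.lefschetzSimilitudeGroupBaseChange K) : (K ⊗[ℚ] V) ≃ₗ[K] (K ⊗[ℚ] V)))
      (Classical.choose_spec (Q.exists_multiplier_of_mem (γ * γ'))).2 fun x y ↦ ?_
    rw [Subgroup.coe_mul, LinearEquiv.mul_apply, LinearEquiv.mul_apply, (Classical.choose_spec (Q.exists_multiplier_of_mem γ)).2,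
      (Classical.choose_spec (Q.exists_multiplier_of_mem γ')).2, mul_assoc]

/-- **`Q_K(γ x, γ y) = l(γ) · Q_K(x, y)`** for `γ ∈ G(H)(K)` ("`e_D(γx, γy) = γ†γ · e_D(x, y)`").
[cite: Milne1999LefschetzClasses, §4 Theorem 4.4 (proof, p. 659)] -/
theorem Polarization.baseChange_form_lefschetzMultiplier (γ : Q.lefschetzSimilitudeGroupBaseChange K) (x y : K ⊗[ℚ] V) :
    Q.form.baseChange K ((γ : (K ⊗[ℚ] V) ≃ₗ[K] (K ⊗[ℚ] V)) x) ((γ : (K ⊗[ℚ] V) ≃ₗ[K] (K ⊗[ℚ] V)) y) =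
      (Q.lefschetzMultiplier K γ : K) * Q.form.baseChange K x y :=
  (Classical.choose_spec (Q.exists_multiplier_of_mem γ)).2 x y

/-- Uniqueness: any `c` with `Q_K(γ x, γ y) = c · Q_K(x, y)` for all `x, y` IS `l(γ)`.
[cite: Milne1999LefschetzClasses, §4 Theorem 4.4 (p. 659)] -/
theorem Polarization.lefschetzMultiplier_eq_of_forall (γ : Q.lefschetzSimilitudeGroupBaseChange K) {c : K}
    (hc : ∀ x y, Q.form.baseChange K ((γ : (K ⊗[ℚ] V) ≃ₗ[K] (K ⊗[ℚ] V)) x) ((γ : (K ⊗[ℚ] V) ≃ₗ[K] (K ⊗[ℚ] V)) y) =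
      c * Q.form.baseChange K x y) :
    (Q.lefschetzMultiplier K γ : K) = c :=
  Q.similitudeFactor_unique K (Q.baseChange_form_lefschetzMultiplier K γ) hc

/-- `l(a · id) = a²` (the scalars; with `w`: `l(w(a)) = a⁻²`, "`l ∘ w = -2`"). [cite: Milne1999LefschetzClasses, §4 p. 659 L31–L34] -/
theorem Polarization.lefschetzMultiplier_smulOfUnit (a : Kˣ) :
    Q.lefschetzMultiplier K ⟨LinearEquiv.smulOfUnit a, Q.smulOfUnit_mem_lefschetzSimilitudeGroupBaseChange K a⟩ = a * a := by
  refine Units.ext (Q.lefschetzMultiplier_eq_of_forall K _ fun x y ↦ ?_)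
  have h := Q.smulOfUnit_mem_extendedLefschetzGroupBaseChange K a 1 x y
  rwa [OneMemClass.coe_one, LinearMap.baseChange_one, Module.End.one_apply, Module.End.one_apply] at h

variable [Module.Finite ℚ V]

/-- **Theorem 4.4, the graph: `(γ, l(γ)) ∈ L(H)(K)` for every `γ ∈ G(H)(K)`** ("`(γ, γ†γ)` fixes `e_D`").
[cite: Milne1999LefschetzClasses, §4 Theorem 4.4 (proof, p. 659)] -/
theorem Polarization.mk_lefschetzMultiplier_mem_extendedLefschetzGroupBaseChange (γ : Q.lefschetzSimilitudeGroupBaseChange K) :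
    (((γ : (K ⊗[ℚ] V) ≃ₗ[K] (K ⊗[ℚ] V))), Q.lefschetzMultiplier K γ) ∈ Q.extendedLefschetzGroupBaseChange K :=
  Q.mk_mem_extendedLefschetzGroupBaseChange_of_mem γ.2 (Q.baseChange_form_lefschetzMultiplier K γ)

variable {K} in
/-- Theorem 4.4, the second coordinate: for `(γ, c) ∈ L(H)(K)`, `c = l(γ)`. [cite: Milne1999LefschetzClasses, §4 Theorem 4.4 (p. 659)] -/
theorem Polarization.snd_eq_lefschetzMultiplier_of_mem {p : ((K ⊗[ℚ] V) ≃ₗ[K] (K ⊗[ℚ] V)) × Kˣ}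
    (hp : p ∈ Q.extendedLefschetzGroupBaseChange K) :
    p.2 = Q.lefschetzMultiplier K ⟨p.1, Q.fst_mem_lefschetzSimilitudeGroupBaseChange_of_mem hp⟩ :=
  Q.snd_eq_snd_of_mem_extendedLefschetzGroupBaseChange hp (Q.mk_lefschetzMultiplier_mem_extendedLefschetzGroupBaseChange K _) rfl

variable {K} in
/-- Theorem 4.4, membership through `l`: `(γ, c) ∈ L(H)(K)` iff `γ ∈ G(H)(K)` and `c = l(γ)`.
[cite: Milne1999LefschetzClasses, §4 Theorem 4.4 (p. 659)] -/
theorem Polarization.mem_extendedLefschetzGroupBaseChange_iff_exists (p : ((K ⊗[ℚ] V) ≃ₗ[K] (K ⊗[ℚ] V)) × Kˣ) :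
    p ∈ Q.extendedLefschetzGroupBaseChange K ↔
      ∃ h : p.1 ∈ Q.lefschetzSimilitudeGroupBaseChange K, p.2 = Q.lefschetzMultiplier K ⟨p.1, h⟩ := by
  refine ⟨fun hp ↦ ⟨Q.fst_mem_lefschetzSimilitudeGroupBaseChange_of_mem hp, Q.snd_eq_lefschetzMultiplier_of_mem hp⟩, ?_⟩
  rintro ⟨h, hc⟩
  have hm := Q.mk_lefschetzMultiplier_mem_extendedLefschetzGroupBaseChange K ⟨p.1, h⟩
  rwa [← hc] at hm

/-- **Theorem 4.4 (Milne 1999) as an isomorphism of groups, on `K`-points: `γ ↦ (γ, γ†γ) : G(H)(K) ≃* L(H)(K)`**, with inverse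
the first projection ("The map `γ ↦ (γ, γ†γ): G(A) → GL(V(A)) × 𝔾_m` sends `G(A)` isomorphically onto `L(A)`"; here `L` is read
on the degree-`2` classes of `H ⊗ H`, which suffice). [cite: Milne1999LefschetzClasses, §4 Theorem 4.4 (p. 659)] -/
def Polarization.lefschetzSimilitudeGroupBaseChangeMulEquiv :
    Q.lefschetzSimilitudeGroupBaseChange K ≃* Q.extendedLefschetzGroupBaseChange K where
  toFun γ := ⟨(((γ : (K ⊗[ℚ] V) ≃ₗ[K] (K ⊗[ℚ] V))), Q.lefschetzMultiplier K γ),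
    Q.mk_lefschetzMultiplier_mem_extendedLefschetzGroupBaseChange K γ⟩
  invFun p := ⟨(p : ((K ⊗[ℚ] V) ≃ₗ[K] (K ⊗[ℚ] V)) × Kˣ).1, Q.fst_mem_lefschetzSimilitudeGroupBaseChange_of_mem p.2⟩
  left_inv _ := rfl
  right_inv p := Subtype.ext (Q.eq_of_mem_extendedLefschetzGroupBaseChange_of_fst_eq
    (Q.mk_lefschetzMultiplier_mem_extendedLefschetzGroupBaseChange K _) p.2 rfl)
  map_mul' γ γ' := Subtype.ext (Prod.ext rfl (map_mul (Q.lefschetzMultiplier K) γ γ'))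

/-- `Θ(γ) = (γ, l(γ))`. [cite: Milne1999LefschetzClasses, §4 Theorem 4.4 (p. 659)] -/
theorem Polarization.coe_lefschetzSimilitudeGroupBaseChangeMulEquiv_apply (γ : Q.lefschetzSimilitudeGroupBaseChange K) :
    ((Q.lefschetzSimilitudeGroupBaseChangeMulEquiv K γ : Q.extendedLefschetzGroupBaseChange K) :
        ((K ⊗[ℚ] V) ≃ₗ[K] (K ⊗[ℚ] V)) × Kˣ) =
      (((γ : (K ⊗[ℚ] V) ≃ₗ[K] (K ⊗[ℚ] V))), Q.lefschetzMultiplier K γ) :=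
  rfl

/-- `Θ⁻¹(γ, c) = γ`. [cite: Milne1999LefschetzClasses, §4 Theorem 4.4 (p. 659)] -/
theorem Polarization.coe_lefschetzSimilitudeGroupBaseChangeMulEquiv_symm_apply (p : Q.extendedLefschetzGroupBaseChange K) :
    (((Q.lefschetzSimilitudeGroupBaseChangeMulEquiv K).symm p : Q.lefschetzSimilitudeGroupBaseChange K) :
        (K ⊗[ℚ] V) ≃ₗ[K] (K ⊗[ℚ] V)) =
      (p : ((K ⊗[ℚ] V) ≃ₗ[K] (K ⊗[ℚ] V)) × Kˣ).1 :=
  rfl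

/-- **`Ker l = S(A)`** through `l`: `l(γ) = 1` iff `γ ∈ S(H)(K)`. [cite: Milne1999LefschetzClasses, §4 p. 659 L28–L31] -/
theorem Polarization.lefschetzMultiplier_eq_one_iff (γ : Q.lefschetzSimilitudeGroupBaseChange K) :
    Q.lefschetzMultiplier K γ = 1 ↔ ((γ : (K ⊗[ℚ] V) ≃ₗ[K] (K ⊗[ℚ] V))) ∈ Q.lefschetzGroupBaseChange K := by
  constructor
  · intro h
    have hm := Q.mk_lefschetzMultiplier_mem_extendedLefschetzGroupBaseChange K γ
    rw [h] at hm
    exact (Q.mk_one_mem_extendedLefschetzGroupBaseChange_iff _).1 hm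
  · intro h
    exact (Q.snd_eq_lefschetzMultiplier_of_mem ((Q.mk_one_mem_extendedLefschetzGroupBaseChange_iff _).2 h)).symm

/-- `Ker l = S(H)(K)` as subgroups of `G(H)(K)`. [cite: Milne1999LefschetzClasses, §4 p. 659 L28–L31] -/
theorem Polarization.ker_lefschetzMultiplier :
    (Q.lefschetzMultiplier K).ker = (Q.lefschetzGroupBaseChange K).subgroupOf (Q.lefschetzSimilitudeGroupBaseChange K) := by
  ext γ
  rw [MonoidHom.mem_ker, Subgroup.mem_subgroupOf, Q.lefschetzMultiplier_eq_one_iff K]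

/-- `l ∘ w = -2`: `l` of the first coordinate `a⁻¹ · id` of `w(a)` is `a⁻²`. [cite: Milne1999LefschetzClasses, §4 p. 659 L34] -/
theorem Polarization.lefschetzMultiplier_fst_lefschetzWeightCocharacter (a : Kˣ) :
    Q.lefschetzMultiplier K ⟨((Q.lefschetzWeightCocharacter K a : Q.extendedLefschetzGroupBaseChange K) :
        ((K ⊗[ℚ] V) ≃ₗ[K] (K ⊗[ℚ] V)) × Kˣ).1,
      Q.fst_mem_lefschetzSimilitudeGroupBaseChange_of_mem (Q.lefschetzWeightCocharacter K a).2⟩ = a ^ (-2 : ℤ) :=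
  (Q.snd_eq_lefschetzMultiplier_of_mem (Q.lefschetzWeightCocharacter K a).2).symm

variable [HodgeTensorFacts.{u, u}]

/-- **`l` restricted to `MT(H)(K) ≤ G(H)(K)` is the multiplier character `ν` of the tree** (Milne p. 660: Hodge classes ⊇
divisor classes, so the character of `Hg(A) ⊂ GL × 𝔾_m` is the restriction of `l(A)`; Moonen (5.2)).
[cite: Milne1999LefschetzClasses, §4 p. 660 L9–L20] [cite: Moonen2004MT, (5.2)] -/
theorem Polarization.lefschetzMultiplier_eq_multiplierChar (γ : H.mumfordTateGroupBaseChange K) :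
    Q.lefschetzMultiplier K ⟨γ, Q.mumfordTateGroupBaseChange_le_lefschetzSimilitudeGroupBaseChange K γ.2⟩ =
      Q.multiplierChar K γ :=
  Units.ext (Q.lefschetzMultiplier_eq_of_forall K _ (Q.baseChange_form_multiplierChar K γ))

/-- **`l` does not depend on the polarization** ("the restriction of `†` to `C(A)` is independent of the choice of `D`", so
`γ†γ` is): for `γ ∈ G_Q(H)(K) = G_{Q'}(H)(K)` the two multipliers agree. [cite: Milne1999LefschetzClasses, §1 p. 643 L1–L2 and §4 Theorem 4.4] -/
theorem Polarization.lefschetzMultiplier_eq_of_polarization (Q Q' : Polarization H) (γ : Q.lefschetzSimilitudeGroupBaseChange K) :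
    (Q.lefschetzMultiplier K γ : K) =
      Q'.lefschetzMultiplier K ⟨γ, (Q.lefschetzSimilitudeGroupBaseChange_eq_of_polarization K Q').le γ.2⟩ := by
  refine (Q'.lefschetzMultiplier_eq_of_forall K _ fun x y ↦ ?_).symm
  exact Q.baseChange_form_apply_apply_eq_mul_of_forall_endAlg_comm K Q'
    (γ := ((γ : (K ⊗[ℚ] V) ≃ₗ[K] (K ⊗[ℚ] V)) : Module.End K (K ⊗[ℚ] V))) γ.2.1 (Q.baseChange_form_lefschetzMultiplier K γ) x y

end Multiplier

/-! ## §6 `L(A) ⊃ Hg(A)`: the Mumford–Tate group with its multiplier lies in `L(H)(K)` -/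

section HodgeGroup

variable (K : Type uK) [Field K] [Algebra ℚ K] [Module.Finite ℚ V] [HodgeTensorFacts.{u, u}] (Q : Polarization H)

variable {K} in
/-- **"Clearly `D_hom(A) ⊂ H(A)`, and so `L(A) ⊃ Hg(A)`"**, on `K`-points, `∃`-form without `V ≠ 0`: every `γ ∈ MT(H)(K)` is the
first coordinate of an element of `L(H)(K)` (`MT(H)(K) ≤ G(H)(K)`, the tree's
`Polarization.mumfordTateGroupBaseChange_le_lefschetzSimilitudeGroupBaseChange`, and Theorem 4.4).
[cite: Milne1999LefschetzClasses, §4 p. 660 L19–L20] -/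
theorem Polarization.exists_mk_mem_extendedLefschetzGroupBaseChange_of_mem_mumfordTateGroupBaseChange
    {γ : (K ⊗[ℚ] V) ≃ₗ[K] (K ⊗[ℚ] V)} (hγ : γ ∈ H.mumfordTateGroupBaseChange K) :
    ∃ c : Kˣ, (γ, c) ∈ Q.extendedLefschetzGroupBaseChange K :=
  Q.exists_mk_mem_extendedLefschetzGroupBaseChange_of_mem (Q.mumfordTateGroupBaseChange_le_lefschetzSimilitudeGroupBaseChange K hγ)

/-- **`L(A) ⊃ Hg(A)` with Milne's `Hg(A) ⊂ GL(V_B(A)) × 𝔾_m`** = the Mumford–Tate group TOGETHER WITH ITS CHARACTER, i.e. (Moonen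
(5.2)) the graph of the multiplier character `ν` on `MT(H)(K)`: `(γ, ν(γ)) ∈ L(H)(K)` for every `γ ∈ MT(H)(K)` (`V ≠ 0`).
[cite: Milne1999LefschetzClasses, §4 p. 660 L9–L20] [cite: Moonen2004MT, (5.2)] -/
theorem Polarization.mk_multiplierChar_mem_extendedLefschetzGroupBaseChange [Nontrivial V] (γ : H.mumfordTateGroupBaseChange K) :
    (((γ : (K ⊗[ℚ] V) ≃ₗ[K] (K ⊗[ℚ] V))), Q.multiplierChar K γ) ∈ Q.extendedLefschetzGroupBaseChange K :=
  Q.mk_mem_extendedLefschetzGroupBaseChange_of_mem (Q.mumfordTateGroupBaseChange_le_lefschetzSimilitudeGroupBaseChange K γ.2)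
    (Q.baseChange_form_multiplierChar K γ)

/-- The same as an inclusion of subgroups of `GL(K ⊗ V) × Kˣ`: the graph of `ν` on `MT(H)(K)` — the range of
`γ ↦ (γ, ν(γ))` — lies in `L(H)(K)`. [cite: Milne1999LefschetzClasses, §4 p. 660 L19–L20] [cite: Moonen2004MT, (5.2)] -/
theorem Polarization.range_prod_multiplierChar_le_extendedLefschetzGroupBaseChange [Nontrivial V] :
    ((H.mumfordTateGroupBaseChange K).subtype.prod (Q.multiplierChar K)).range ≤ Q.extendedLefschetzGroupBaseChange K := by
  rintro _ ⟨γ, rfl⟩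
  exact Q.mk_multiplierChar_mem_extendedLefschetzGroupBaseChange K γ

variable {K} in
/-- **`L(A) ⊃ Hg(A)` in Deligne's normalisation of the extended Mumford–Tate group `G ⊂ GL(V) × 𝔾_m`** (the tree's
`extendedMumfordTateGroupBaseChange`, `𝔾_m` acting on `ℚ(1)` by `ν ↦ ν⁻¹`, so that "`ψ(g₁v, g₁v') = g₂ⁿ ψ(v, v')`", the tree's
`Polarization.baseChange_form_apply_of_mem_extendedMumfordTateGroupBaseChange`): `(g, ν) ∈ G(K) ⟹ (g, νⁿ) ∈ L(H)(K)` — the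
multiplier of a weight-`n` polarization is the `n`-th power of Deligne's `𝔾_m`-coordinate (for `H¹` of an abelian variety,
`n = 1`, the two coordinates agree). [cite: Milne1999LefschetzClasses, §4 p. 660 L9–L20] [cite: Deligne1982HodgeCycles, I §3 proof of Prop. 3.6] -/
theorem Polarization.mk_zpow_mem_extendedLefschetzGroupBaseChange_of_mem {γ : ((K ⊗[ℚ] V) ≃ₗ[K] (K ⊗[ℚ] V)) × Kˣ}
    (hγ : γ ∈ H.extendedMumfordTateGroupBaseChange K) : (γ.1, γ.2 ^ n) ∈ Q.extendedLefschetzGroupBaseChange K :=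
  Q.mk_mem_extendedLefschetzGroupBaseChange_of_mem
    (Q.mumfordTateGroupBaseChange_le_lefschetzSimilitudeGroupBaseChange K (fst_mem_mumfordTateGroupBaseChange_of_mem K H hγ))
    fun x y ↦ by
      rw [Units.val_zpow_eq_zpow_val]
      exact Q.baseChange_form_apply_of_mem_extendedMumfordTateGroupBaseChange K hγ x y

/-- The same as an inclusion of subgroups: the image of Deligne's `G(K)` under `(g, ν) ↦ (g, νⁿ)` lies in `L(H)(K)`.
[cite: Milne1999LefschetzClasses, §4 p. 660 L19–L20] [cite: Deligne1982HodgeCycles, I §3 proof of Prop. 3.6] -/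
theorem Polarization.map_extendedMumfordTateGroupBaseChange_le_extendedLefschetzGroupBaseChange :
    (H.extendedMumfordTateGroupBaseChange K).map ((MonoidHom.id _).prodMap (zpowGroupHom n)) ≤
      Q.extendedLefschetzGroupBaseChange K := by
  rintro _ ⟨γ, hγ, rfl⟩
  exact Q.mk_zpow_mem_extendedLefschetzGroupBaseChange_of_mem hγ

/-- Consistency of the two kernels: `(g, 1) ∈ G(K) ⟺ g ∈ Hg(H)(K)` (the tree) and `(γ, 1) ∈ L(H)(K) ⟺ γ ∈ S(H)(K)` (§3) —
and indeed `Hg(H)(K) ≤ S(H)(K)` (the tree's `Polarization.hodgeGroupBaseChange_le_lefschetzGroupBaseChange`), so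
`Hg(H)(K) × {1} ≤ L(H)(K)`: "`Hg′(A)`" (the kernel of the character of `Hg(A)`) maps into `S(A) = Ker l(A)`, the left square of
the diagram in the proof of Proposition 4.8. [cite: Milne1999LefschetzClasses, §4 Proposition 4.8 (proof, p. 660)] -/
theorem Polarization.prod_hodgeGroupBaseChange_bot_le_extendedLefschetzGroupBaseChange :
    (H.hodgeGroupBaseChange K).prod ⊥ ≤ Q.extendedLefschetzGroupBaseChange K :=
  (Subgroup.prod_mono (Q.hodgeGroupBaseChange_le_lefschetzGroupBaseChange K) le_rfl).trans
    (Q.prod_lefschetzGroupBaseChange_bot_le K)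

end HodgeGroup

/-! ## §7 Proposition 4.8 (b) ⇔ (c) on points: `Hg(A) = L(A)` versus `Hg′(A) = S(A)` -/

section PropositionFourEight

variable (K : Type uK) [Field K] [Algebra ℚ K] [Module.Finite ℚ V] (Q : Polarization H)

/-- An element of `G(H)(K)` whose multiplier is a square `d²` is `d` times an element of `S(H)(K)`: `d⁻¹ γ ∈ S(H)(K)`.
[cite: Milne1999LefschetzClasses, §4 p. 659 L28–L34] -/
theorem Polarization.smulOfUnit_inv_mul_mem_lefschetzGroupBaseChange {γ : (K ⊗[ℚ] V) ≃ₗ[K] (K ⊗[ℚ] V)}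
    (hγ : γ ∈ Q.lefschetzSimilitudeGroupBaseChange K) {d : Kˣ}
    (hd : ∀ x y, Q.form.baseChange K (γ x) (γ y) = ((d * d : Kˣ) : K) * Q.form.baseChange K x y) :
    LinearEquiv.smulOfUnit d⁻¹ * γ ∈ Q.lefschetzGroupBaseChange K := by
  have hmem := (Q.extendedLefschetzGroupBaseChange K).mul_mem (Q.smulOfUnit_mem_extendedLefschetzGroupBaseChange K d⁻¹)
    (Q.mk_mem_extendedLefschetzGroupBaseChange_of_mem hγ hd)
  rw [Prod.mk_mul_mk, ← mul_inv, inv_mul_cancel] at hmem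
  exact (Q.mk_one_mem_extendedLefschetzGroupBaseChange_iff _).1 hmem

variable [HodgeTensorFacts.{u, u}] [Nontrivial V]

/-- **Proposition 4.8, (b) ⟹ (c), on `K`-points in odd weight**: if `MT(H)(K) = G(H)(K)` ("`Hg(A) = L(A)`": both are graphs
over their first projections, Theorem 4.4 and Moonen (5.2)) then `Hg(H)(K) = S(H)(K)` ("`Hg′(A) = S(A)`": the two kernels —
`Hg(H)(K) = Ker ν` in odd weight, the tree's `Polarization.mem_hodgeGroupBaseChange_iff_of_odd`, and `S = Ker l`).
[cite: Milne1999LefschetzClasses, §4 Proposition 4.8 (p. 660)] -/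
theorem Polarization.hodgeGroupBaseChange_eq_lefschetzGroupBaseChange_of_eq (hn : Odd n)
    (h : H.mumfordTateGroupBaseChange K = Q.lefschetzSimilitudeGroupBaseChange K) :
    H.hodgeGroupBaseChange K = Q.lefschetzGroupBaseChange K := by
  refine le_antisymm (Q.hodgeGroupBaseChange_le_lefschetzGroupBaseChange K) fun γ hγ ↦ ?_
  refine (Q.mem_hodgeGroupBaseChange_iff_of_odd K hn γ).2 ⟨?_, hγ.2⟩
  rw [h]
  exact Q.lefschetzGroupBaseChange_le_lefschetzSimilitudeGroupBaseChange K hγ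

omit [Nontrivial V] in
/-- **Proposition 4.8, (c) ⟹ (b), on `K`-points in odd weight, for a field `K` in which every element is a square** (e.g.
`K` algebraically closed — Milne's groups are determined by their `k^{al}`-points): if `Hg(H)(K) = S(H)(K)` then
`MT(H)(K) = G(H)(K)`. Proof: `MT ≤ G` always; for `γ ∈ G(H)(K)` with multiplier `c = d²`, `d⁻¹γ ∈ S(H)(K) = Hg(H)(K) ≤ MT(H)(K)`
and the homothety `d ∈ MT(H)(K)` (`n ≠ 0`, the tree's `smulOfUnit_mem_mumfordTateGroupBaseChange`), so `γ ∈ MT(H)(K)` — the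
right square of the diagram `0 → S(A) → L(A) → 𝔾_m → 0` over `0 → Hg′(A) → Hg(A) → 𝔾_m → 0`, where on points the
surjectivity onto `𝔾_m` is replaced by the square roots. [cite: Milne1999LefschetzClasses, §4 Proposition 4.8 (proof, p. 660)] -/
theorem Polarization.mumfordTateGroupBaseChange_eq_lefschetzSimilitudeGroupBaseChange_of_eq (hn : Odd n)
    (hsq : ∀ c : K, IsSquare c) (h : H.hodgeGroupBaseChange K = Q.lefschetzGroupBaseChange K) :
    H.mumfordTateGroupBaseChange K = Q.lefschetzSimilitudeGroupBaseChange K := by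
  have hn0 : n ≠ 0 := by
    obtain ⟨k, hk⟩ := hn
    omega
  refine le_antisymm (Q.mumfordTateGroupBaseChange_le_lefschetzSimilitudeGroupBaseChange K) fun γ hγ ↦ ?_
  obtain ⟨c, hc0, hc⟩ := hγ.2
  obtain ⟨d, hdc⟩ := hsq c
  have hd0 : d ≠ 0 := fun h0 ↦ hc0 (by rw [hdc, h0, mul_zero])
  have hS : LinearEquiv.smulOfUnit (Units.mk0 d hd0)⁻¹ * γ ∈ Q.lefschetzGroupBaseChange K :=
    Q.smulOfUnit_inv_mul_mem_lefschetzGroupBaseChange K hγ fun x y ↦ by rw [Units.val_mul, Units.val_mk0, ← hdc, hc]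
  rw [← h] at hS
  have hMT : LinearEquiv.smulOfUnit (Units.mk0 d hd0) * (LinearEquiv.smulOfUnit (Units.mk0 d hd0)⁻¹ * γ) ∈
      H.mumfordTateGroupBaseChange K :=
    (H.mumfordTateGroupBaseChange K).mul_mem (smulOfUnit_mem_mumfordTateGroupBaseChange K H hn0 _)
      (hodgeGroupBaseChange_le_mumfordTateGroupBaseChange K H hS)
  rwa [smulOfUnit_mul_smulOfUnit_inv_mul] at hMT

/-- **Proposition 4.8 (b) ⇔ (c), on `K`-points, for `K` algebraically closed and odd weight**: `Hg(H)(K) = S(H)(K)` iff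
`MT(H)(K) = G(H)(K)` ("(b) `Hg(A) = L(A)`; (c) `Hg′(A) = S(A)` […] the equivalence of the second two follows from applying
the Five Lemma to the diagram"). [cite: Milne1999LefschetzClasses, §4 Proposition 4.8 (p. 660)] -/
theorem Polarization.hodgeGroupBaseChange_eq_lefschetzGroupBaseChange_iff [IsAlgClosed K] (hn : Odd n) :
    H.hodgeGroupBaseChange K = Q.lefschetzGroupBaseChange K ↔
      H.mumfordTateGroupBaseChange K = Q.lefschetzSimilitudeGroupBaseChange K :=
  ⟨Q.mumfordTateGroupBaseChange_eq_lefschetzSimilitudeGroupBaseChange_of_eq K hn fun c ↦ by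
      obtain ⟨z, hz⟩ := IsAlgClosed.exists_eq_mul_self c
      exact ⟨z, hz⟩,
    Q.hodgeGroupBaseChange_eq_lefschetzGroupBaseChange_of_eq K hn⟩

/-- **Proposition 4.8 (b) literally, "`Hg(A) = L(A)`" inside `GL × 𝔾_m`, on `K`-points**: Milne's `Hg(A)(K)` — the graph of the
multiplier character `ν` on `MT(H)(K)` (Moonen (5.2)) — EQUALS `L(H)(K)` iff `MT(H)(K) = G(H)(K)` (both groups are the graphs
of `γ ↦ γ†γ` over their first projections, Theorem 4.4). [cite: Milne1999LefschetzClasses, §4 Proposition 4.8 (p. 660)] [cite: Moonen2004MT, (5.2)] -/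
theorem Polarization.range_prod_multiplierChar_eq_extendedLefschetzGroupBaseChange_iff :
    ((H.mumfordTateGroupBaseChange K).subtype.prod (Q.multiplierChar K)).range = Q.extendedLefschetzGroupBaseChange K ↔
      H.mumfordTateGroupBaseChange K = Q.lefschetzSimilitudeGroupBaseChange K := by
  constructor
  · intro h
    rw [← Q.map_fst_extendedLefschetzGroupBaseChange K, ← h, MonoidHom.range_eq_map, Subgroup.map_map]
    ext γ
    constructor
    · intro hγ
      exact ⟨⟨γ, hγ⟩, Subgroup.mem_top _, rfl⟩
    · rintro ⟨δ, -, rfl⟩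
      exact δ.2
  · intro h
    refine le_antisymm (Q.range_prod_multiplierChar_le_extendedLefschetzGroupBaseChange K) fun p hp ↦ ?_
    have h1 : p.1 ∈ H.mumfordTateGroupBaseChange K := by
      rw [h]
      exact Q.fst_mem_lefschetzSimilitudeGroupBaseChange_of_mem hp
    exact ⟨⟨p.1, h1⟩, Q.eq_of_mem_extendedLefschetzGroupBaseChange_of_fst_eq
      (Q.mk_multiplierChar_mem_extendedLefschetzGroupBaseChange K ⟨p.1, h1⟩) hp rfl⟩

end PropositionFourEight

end HodgeStructure

end Literature.AlgebraicGeometry.Motives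

end
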